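import Mathlib.Topology.Algebra.Order.Floor
import Literature.Topology.PlaneTopology.SimpleArcs
import Literature.Topology.PlaneTopology.JordanCurveProofs
import Literature.Topology.PlaneTopology.Janiszewski
import Literature.Probability.RandomPlanarGeometry.PlanarDomainsTopology
import HarnessLib

/-!
# Proof of Newman's cross-cut theorem for a Jordan domain

Topic: Topology / PlaneTopology. This file discharges the named fact `Literature.Topology.PlaneTopology.Newman1939_crosscut`
(`Crosscut.lean`; M. H. A. Newman, *Elements of the topology of plane sets of points* (1939),
Ch. V §11, Thms. 11·7–11·8, pp. 94–95) as `Newman1939_crosscut_holds`, from the Jordan curve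
theorem (`JordanCurveTheorem_holds`, `JordanCurveProofs.lean`) and Janiszewski's theorem
(`Literature.Topology.PlaneTopology.janiszewski`, `Janiszewski.lean`). Newman proves 11·7 by his grating/Alexander-lemma
machinery ("exactly like part I of Jordan's theorem"); the argument below is the classical
*θ-curve* argument (cf. Newman 1939, Ch. V §11; Pommerenke 1992, §1.1–§2.2), which needs only the
two inputs just named:

Let `D` be a Jordan domain with boundary curve `J`, `L` a cross-cut from `a = boundary s` to
`b = boundary t` (`s < t < s + 1`), and `A₁ = boundary [s, t]`, `A₂ = boundary [t, s + 1]` the two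
arcs of `J`, so `J = A₁ ∪ A₂`, `A₁ ∩ A₂ = {a, b} = L ∩ J`.
1. `J₁ = L ∪ A₁` and `J₂ = L ∪ A₂` are Jordan curves (two simple arcs with common end-points glue
   to a loop, `IsSimpleArc.exists_periodic_of_union`); let `Uᵢ` be the inside and `Vᵢ` the outside
   of `Jᵢ` (`JordanCurveTheorem.of_periodic`).
2. The exterior `E` of `D` is connected, unbounded and misses `Jᵢ`, so `E ⊆ Vᵢ`; as `J = ∂E`, the
   open set `Uᵢ` (disjoint from `Vᵢ ⊇ E`) misses `J`, hence lies in `D` (connectedness), hence in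
   `D ∖ L`.
3. `U₁ ∩ U₂ = ∅`: otherwise `U₁ = U₂` (each is connected and misses the other's boundary curve), so
   `J₁ = ∂U₁ = ∂U₂ = J₂`, which fails at the point `boundary ((s + t)/2) ∈ A₁ ∖ J₂`.
4. `D ∖ L ⊆ U₁ ∪ U₂` (*Janiszewski*): a point `z ∈ D ∖ L` outside both `Uᵢ` lies in `V₁ ∩ V₂`,
   as does any `y ∈ E`; so neither `J₁` nor `J₂` separates `z` from `y`, and `J₁ ∩ J₂ = L` is
   connected, hence `J₁ ∪ J₂ = J ∪ L` does not separate them — but every connected set through `z`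
   missing `J` stays in `D ∌ y`.
5. `∂U₁ = J₁ = L ∪ A₁`, `∂U₂ = J₂ = L ∪ A₂` by the Jordan curve theorem.

Mathlib anchors: `IsPreconnected.subset_or_subset`, `connectedComponentIn`,
`IsPreconnected.subset_connectedComponentIn`, `ContinuousOn.comp_fract''`, `Int.fract`.
Mathlib has neither the Jordan curve theorem nor cross-cuts/θ-curves (searched `crosscut`,
`theta_curve`, `Jordan`).

## References
* M. H. A. Newman, *Elements of the topology of plane sets of points*, Cambridge Univ. Press
  (1939), Ch. V §11, Thms. 11·7, 11·8, pp. 94–95. [Newman1939]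
* Ch. Pommerenke, *Boundary Behaviour of Conformal Maps*, Springer (1992), §1.1 (Janiszewski),
  Prop. 2.12 (cross-cuts). [PommerenkeBBCM1992]
-/

noncomputable section

namespace Literature.Topology.PlaneTopology

open Set _root_.Topology Metric Bornology

namespace IsSimpleArc

variable {L₁ L₂ : Set ℂ} {a b : ℂ}

/-- **Two arcs make a loop.** If `L₁` is a simple arc from `a` to `b` and `L₂` a simple arc from
`b` back to `a`, meeting only in `{a, b}`, then `L₁ ∪ L₂` is the range of a continuous
`1`-periodic map `ℝ → ℂ` injective on `[0, 1)` (run through `L₁` on `[0, ½]` and through `L₂` on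
`[½, 1]`, then periodise with `Int.fract`) — i.e. a Jordan curve in the parametrised form of
`JordanCurveTheorem.of_periodic`. (Newman 1939, Ch. V §11: the θ-curve `J ∪ L` contains the
simple closed curves `L ∪ L₁`, `L ∪ L₂`.) [cite: Newman1939, Ch. V §11 pp. 94–95] -/
theorem exists_periodic_of_union (h₁ : IsSimpleArc L₁ a b) (h₂ : IsSimpleArc L₂ b a)
    (h : L₁ ∩ L₂ ⊆ {a, b}) :
    ∃ γ : ℝ → ℂ, Continuous γ ∧ Function.Periodic γ 1 ∧ InjOn γ (Ico 0 1) ∧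
      range γ = L₁ ∪ L₂ := by
  obtain ⟨γ₁, hγ₁, hinj₁, hL₁, h0₁, h1₁⟩ := isSimpleArc_iff_continuous.1 h₁
  obtain ⟨γ₂, hγ₂, hinj₂, hL₂, h0₂, h1₂⟩ := isSimpleArc_iff_continuous.1 h₂
  set f : ℝ → ℂ := fun t => if t ≤ 1 / 2 then γ₁ (2 * t) else γ₂ (2 * t - 1) with hf
  have hfc : Continuous f := by
    refine Continuous.if_le (hγ₁.comp (by fun_prop)) (hγ₂.comp (by fun_prop)) continuous_id
      continuous_const ?_
    rintro t rfl
    norm_num [h1₁, h0₂]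
  have hfl : ∀ t, t ≤ 1 / 2 → f t = γ₁ (2 * t) := fun t ht => by
    show (if t ≤ 1 / 2 then γ₁ (2 * t) else γ₂ (2 * t - 1)) = _
    rw [if_pos ht]
  have hfr : ∀ t, 1 / 2 ≤ t → f t = γ₂ (2 * t - 1) := fun t ht => by
    show (if t ≤ 1 / 2 then γ₁ (2 * t) else γ₂ (2 * t - 1)) = _
    rcases ht.eq_or_lt with rfl | ht
    · rw [if_pos le_rfl]; norm_num [h1₁, h0₂]
    · rw [if_neg (not_le.2 ht)]
  have hf0 : f 0 = a := by rw [hfl 0 (by norm_num), mul_zero, h0₁]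
  have hf1 : f 1 = a := by rw [hfr 1 (by norm_num)]; norm_num [h1₂]
  -- the image of `[0, 1)` is `L₁ ∪ L₂`
  have hfimage : f '' Ico 0 1 = L₁ ∪ L₂ := by
    apply Subset.antisymm
    · rintro _ ⟨u, hu, rfl⟩
      rcases le_or_gt u (1 / 2) with hu' | hu'
      · left
        rw [hfl u hu', ← hL₁]
        exact mem_image_of_mem _ ⟨by linarith [hu.1], by linarith⟩
      · right
        rw [hfr u hu'.le, ← hL₂]
        exact mem_image_of_mem _ ⟨by linarith, by linarith [hu.2]⟩
    · rintro z (hz | hz)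
      · rw [← hL₁] at hz
        obtain ⟨v, hv, rfl⟩ := hz
        refine ⟨v / 2, ⟨by linarith [hv.1], by linarith [hv.2]⟩, ?_⟩
        rw [hfl _ (by linarith [hv.2])]
        congr 1
        ring
      · rw [← hL₂] at hz
        obtain ⟨v, hv, rfl⟩ := hz
        rcases eq_or_lt_of_le hv.2 with rfl | hv1
        · exact ⟨0, ⟨le_rfl, one_pos⟩, by rw [hf0, h1₂]⟩
        · refine ⟨(v + 1) / 2, ⟨by linarith [hv.1], by linarith⟩, ?_⟩
          rw [hfr _ (by linarith [hv.1])]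
          congr 1
          ring
  -- `f` is injective on `[0, 1)`
  have hfinj : InjOn f (Ico 0 1) := by
    have key : ∀ u ∈ Ico (0 : ℝ) 1, ∀ u' ∈ Ico (0 : ℝ) 1, u ≤ 1 / 2 → 1 / 2 < u' →
        f u ≠ f u' := by
      intro u hu u' hu' hle hlt heq
      rw [hfl u hle, hfr u' hlt.le] at heq
      have hmem : γ₁ (2 * u) ∈ L₁ ∩ L₂ := by
        refine ⟨?_, ?_⟩
        · rw [← hL₁]
          exact mem_image_of_mem _ ⟨by linarith [hu.1], by linarith⟩
        · rw [heq, ← hL₂]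
          exact mem_image_of_mem _ ⟨by linarith, by linarith [hu'.2]⟩
      rcases h hmem with ha | hb
      · have e : γ₂ (2 * u' - 1) = γ₂ 1 := by rw [← heq, ha, h1₂]
        have := hinj₂ ⟨by linarith, by linarith [hu'.2]⟩ (right_mem_Icc.2 zero_le_one) e
        linarith [hu'.2]
      · have e : γ₂ (2 * u' - 1) = γ₂ 0 := by rw [← heq, hb, h0₂]
        have := hinj₂ ⟨by linarith, by linarith [hu'.2]⟩ (left_mem_Icc.2 zero_le_one) e
        linarith
    intro u hu u' hu' heq
    rcases le_or_gt u (1 / 2) with hle | hlt <;> rcases le_or_gt u' (1 / 2) with hle' | hlt'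
    · rw [hfl u hle, hfl u' hle'] at heq
      have := hinj₁ ⟨by linarith [hu.1], by linarith⟩ ⟨by linarith [hu'.1], by linarith⟩ heq
      linarith
    · exact absurd heq (key u hu u' hu' hle hlt')
    · exact absurd heq.symm (key u' hu' u hu hle' hlt)
    · rw [hfr u hlt.le, hfr u' hlt'.le] at heq
      have := hinj₂ ⟨by linarith, by linarith [hu.2]⟩ ⟨by linarith, by linarith [hu'.2]⟩ heq
      linarith
  -- periodise with the fractional part
  refine ⟨f ∘ Int.fract, hfc.continuousOn.comp_fract'' (by rw [hf0, hf1]), fun u => ?_, ?_, ?_⟩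
  · simp only [Function.comp_apply, Int.fract_add_one]
  · intro u hu u' hu' heq
    simp only [Function.comp_apply, Int.fract_eq_self.2 ⟨hu.1, hu.2⟩,
      Int.fract_eq_self.2 ⟨hu'.1, hu'.2⟩] at heq
    exact hfinj hu hu' heq
  · rw [← hfimage]
    ext z
    constructor
    · rintro ⟨u, rfl⟩
      exact ⟨Int.fract u, ⟨Int.fract_nonneg u, Int.fract_lt_one u⟩, rfl⟩
    · rintro ⟨u, hu, rfl⟩
      exact ⟨u, by simp only [Function.comp_apply, Int.fract_eq_self.2 ⟨hu.1, hu.2⟩]⟩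

/-- **Jordan curve theorem for the union of two arcs** (θ-curve input): two simple arcs from `a`
to `b` and from `b` to `a` meeting only in `{a, b}` bound an inside `U` (bounded) and an outside
`V` (unbounded): disjoint open connected sets with `U ∪ V = (L₁ ∪ L₂)ᶜ` and common frontier
`L₁ ∪ L₂`. From `JordanCurveTheorem` via `exists_periodic_of_union`. [cite: Newman1939, Ch. V §11 pp. 94–95] -/
theorem exists_inside_outside_of_union (hJ : JordanCurveTheorem) (h₁ : IsSimpleArc L₁ a b)
    (h₂ : IsSimpleArc L₂ b a) (h : L₁ ∩ L₂ ⊆ {a, b}) :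
    ∃ U V : Set ℂ, IsOpen U ∧ IsOpen V ∧ IsConnected U ∧ IsConnected V ∧ Disjoint U V ∧
      U ∪ V = (L₁ ∪ L₂)ᶜ ∧ frontier U = L₁ ∪ L₂ ∧ frontier V = L₁ ∪ L₂ ∧
      IsBounded U ∧ ¬ IsBounded V := by
  obtain ⟨γ, hγ, hp, hinj, hrange⟩ := h₁.exists_periodic_of_union h₂ h
  have := hJ.of_periodic hγ hp hinj
  rwa [hrange] at this

end IsSimpleArc

section JordanDomain
open Literature.Probability.RandomPlanarGeometry (JordanDomain)
open Literature.Probability.RandomPlanarGeometry.JordanDomain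

variable (D : JordanDomain)

/-- The boundary loop is injective on every closed parameter interval of length `< 1`. [folklore] -/
theorem _root_.Literature.Probability.RandomPlanarGeometry.JordanDomain.injOn_boundary_Icc {s t : ℝ} (hts : t < s + 1) : InjOn D.boundary (Icc s t) :=
  (D.injOn_boundary_Ico s).mono (Icc_subset_Ico_right hts)

/-- **Boundary arcs are simple arcs**: for `s < t < s + 1`, `boundary '' [s, t]` is a simple arc
from `boundary s` to `boundary t` (affine reparametrisation of `[0, 1]` onto `[s, t]`).
[folklore] -/
theorem _root_.Literature.Probability.RandomPlanarGeometry.JordanDomain.isSimpleArc_image_boundary {s t : ℝ} (hst : s < t) (hts : t < s + 1) :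
    IsSimpleArc (D.boundary '' Icc s t) (D.boundary s) (D.boundary t) := by
  have hts0 : (0 : ℝ) < t - s := sub_pos.2 hst
  have hmem : ∀ v ∈ Icc (0 : ℝ) 1, s + v * (t - s) ∈ Icc s t := fun v hv =>
    ⟨by nlinarith [hv.1], by nlinarith [hv.2]⟩
  refine ⟨fun u => D.boundary (s + u * (t - s)),
    (D.continuous_boundary.comp (by fun_prop)).continuousOn, ?_, ?_, by simp, by simp⟩
  · intro u hu u' hu' heq
    have h := D.injOn_boundary_Icc hts (hmem u hu) (hmem u' hu') heq
    have : u * (t - s) = u' * (t - s) := by linarith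
    exact mul_right_cancel₀ hts0.ne' this
  · ext z
    constructor
    · rintro ⟨u, hu, rfl⟩
      exact ⟨_, hmem u hu, rfl⟩
    · rintro ⟨v, hv, rfl⟩
      refine ⟨(v - s) / (t - s), ⟨div_nonneg (by linarith [hv.1]) hts0.le,
        (div_le_one hts0).2 (by linarith [hv.2])⟩, ?_⟩
      simp only
      congr 1
      field_simp
      ring

/-- The boundary curve is the union of the two arcs cut off by parameters `s < t < s + 1`:
`∂D = boundary '' [s, t] ∪ boundary '' [t, s + 1]`. [folklore] -/
theorem _root_.Literature.Probability.RandomPlanarGeometry.JordanDomain.frontier_eq_union_image_boundary (s t : ℝ) :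
    frontier D.carrier = D.boundary '' Icc s t ∪ D.boundary '' Icc t (s + 1) := by
  apply Subset.antisymm
  · intro z hz
    rw [← D.range_boundary] at hz
    obtain ⟨v, rfl⟩ := hz
    obtain ⟨w, hw, hwv⟩ := D.periodic_boundary.exists_mem_Ico one_pos v s
    rw [hwv]
    rcases le_or_gt w t with hwt | hwt
    · exact Or.inl ⟨w, ⟨hw.1, hwt⟩, rfl⟩
    · exact Or.inr ⟨w, ⟨hwt.le, hw.2.le⟩, rfl⟩
  · rintro z (⟨v, -, rfl⟩ | ⟨v, -, rfl⟩) <;> exact D.boundary_mem_frontier v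

/-- The two arcs `boundary '' [s, t]` and `boundary '' [t, s + 1]` (`s < t < s + 1`) meet only at
their common end-points `boundary s`, `boundary t`. [folklore] -/
theorem _root_.Literature.Probability.RandomPlanarGeometry.JordanDomain.image_boundary_inter_subset {s t : ℝ} (hst : s < t) (hts : t < s + 1) :
    D.boundary '' Icc s t ∩ D.boundary '' Icc t (s + 1) ⊆ {D.boundary s, D.boundary t} := by
  rintro z ⟨⟨v, hv, rfl⟩, ⟨v', hv', hvv'⟩⟩
  rcases eq_or_lt_of_le hv'.2 with rfl | hv'1
  · left
    rw [← hvv', D.periodic_boundary]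
  · right
    have h := D.injOn_boundary_Ico s ⟨hv.1, by linarith [hv.2]⟩ ⟨by linarith [hv'.1], hv'1⟩
      hvv'.symm
    have hvt : v = t := le_antisymm hv.2 (h ▸ hv'.1)
    rw [hvt]
    exact mem_singleton _

end JordanDomain

/-- **Newman's cross-cut theorem holds** (Newman, *Elements of the topology of plane sets of
points* (1939), Ch. V §11, Thms. 11·7–11·8, pp. 94–95): a cross-cut `L` of a Jordan domain `D`
from `boundary s` to `boundary t` (`s < t < s + 1`) splits `D ∖ L` into two disjoint domains
`U₁`, `U₂` with `∂U₁ = L ∪ boundary '' [s, t]` and `∂U₂ = L ∪ boundary '' [t, s + 1]`.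
Discharges the named fact `Newman1939_crosscut` of `Crosscut.lean`; proof (θ-curve argument
from the Jordan curve theorem and Janiszewski's theorem) in the module docstring.
[cite: Newman1939, Ch. V §11, Thms. 11·7 and 11·8, pp. 94–95] -/
theorem Newman1939_crosscut_holds : Newman1939_crosscut := by
  intro D L s t hst hts hL
  obtain ⟨hLarc, haF, hbF, -, hLD⟩ := hL
  -- the two boundary arcs `A₁`, `A₂`
  set A₁ : Set ℂ := D.boundary '' Icc s t with hA₁
  set A₂ : Set ℂ := D.boundary '' Icc t (s + 1) with hA₂
  have hA₁arc : IsSimpleArc A₁ (D.boundary s) (D.boundary t) := D.isSimpleArc_image_boundary hst hts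
  have hA₂arc : IsSimpleArc A₂ (D.boundary t) (D.boundary s) := by
    have h := D.isSimpleArc_image_boundary (s := t) (t := s + 1) hts (by linarith)
    rwa [D.periodic_boundary] at h
  have hA₁F : A₁ ⊆ frontier D.carrier := by
    rintro _ ⟨v, -, rfl⟩
    exact D.boundary_mem_frontier v
  have hA₂F : A₂ ⊆ frontier D.carrier := by
    rintro _ ⟨v, -, rfl⟩
    exact D.boundary_mem_frontier v
  have hFA : frontier D.carrier = A₁ ∪ A₂ := D.frontier_eq_union_image_boundary s t
  -- `L` meets the boundary curve only at its end-points
  have hLF : ∀ z ∈ L, z ∈ frontier D.carrier → z = D.boundary s ∨ z = D.boundary t := by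
    intro z hzL hzF
    by_contra hne
    push Not at hne
    have hzD : z ∈ D.carrier := hLD ⟨hzL, by simp [hne.1, hne.2]⟩
    exact Set.disjoint_left.1 D.disjoint_carrier_frontier hzD hzF
  have hLA₁ : L ∩ A₁ ⊆ {D.boundary s, D.boundary t} := fun z ⟨hzL, hzA⟩ => by
    rcases hLF z hzL (hA₁F hzA) with rfl | rfl <;> simp
  have hLA₂ : L ∩ A₂ ⊆ {D.boundary s, D.boundary t} := fun z ⟨hzL, hzA⟩ => by
    rcases hLF z hzL (hA₂F hzA) with rfl | rfl <;> simp
  have hA₁A₂ : A₁ ∩ A₂ ⊆ {D.boundary s, D.boundary t} := D.image_boundary_inter_subset hst hts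
  -- the Jordan curve theorem for `J₁ = L ∪ A₁` and `J₂ = L ∪ A₂`
  obtain ⟨U₁, V₁, hU₁o, hV₁o, hU₁c, hV₁c, hUV₁, hunion₁, hfU₁, -, hU₁b, -⟩ :=
    hLarc.exists_inside_outside_of_union JordanCurveTheorem_holds hA₁arc.symm hLA₁
  obtain ⟨U₂, V₂, hU₂o, hV₂o, hU₂c, hV₂c, hUV₂, hunion₂, hfU₂, -, hU₂b, -⟩ :=
    hLarc.exists_inside_outside_of_union JordanCurveTheorem_holds hA₂arc hLA₂
  -- the exterior `E` of `D`
  obtain ⟨E, hEo, hEc, hDE, hDEu, hfE, hEb⟩ := D.exists_outside JordanCurveTheorem_holds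
  have hEF : E ⊆ (frontier D.carrier)ᶜ := fun z hz => hDEu ▸ (Or.inr hz)
  have hEL : ∀ z ∈ E, z ∉ L := by
    intro z hzE hzL
    by_cases hz : z ∈ ({D.boundary s, D.boundary t} : Set ℂ)
    · rcases hz with rfl | rfl
      · exact hEF hzE haF
      · exact hEF hzE hbF
    · exact Set.disjoint_left.1 hDE (hLD ⟨hzL, hz⟩) hzE
  have hEJ : ∀ A ⊆ frontier D.carrier, E ⊆ (L ∪ A)ᶜ := by
    rintro A hA z hzE (hz | hz)
    · exact hEL z hzE hz
    · exact hEF hzE (hA hz)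
  -- `E` lies in the outside `Vᵢ`
  have hEV : ∀ {U V A : Set ℂ}, A ⊆ frontier D.carrier → IsOpen U → IsOpen V → Disjoint U V →
      U ∪ V = (L ∪ A)ᶜ → IsBounded U → E ⊆ V := by
    intro U V A hA hUo hVo hUV hunion hUb
    rcases hEc.isPreconnected.subset_or_subset hUo hVo hUV (hunion.symm ▸ hEJ A hA) with h | h
    · exact absurd (hUb.subset h) hEb
    · exact h
  have hEV₁ : E ⊆ V₁ := hEV hA₁F hU₁o hV₁o hUV₁ hunion₁ hU₁b
  have hEV₂ : E ⊆ V₂ := hEV hA₂F hU₂o hV₂o hUV₂ hunion₂ hU₂b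
  -- the inside `Uᵢ` lies in `D ∖ L`
  have key : ∀ {U V A : Set ℂ}, IsOpen U → IsConnected U → Disjoint U V →
      U ∪ V = (L ∪ A)ᶜ → E ⊆ V → U ⊆ D.carrier \ L := by
    intro U V A hUo hUc hUV hunion hEV z hz
    have hzJ : z ∈ (L ∪ A)ᶜ := hunion ▸ Or.inl hz
    have hUF : U ⊆ (frontier D.carrier)ᶜ := by
      intro w hw hwF
      have hwE : w ∈ closure E := by
        rw [← hfE] at hwF
        exact frontier_subset_closure hwF
      obtain ⟨e, heU, heE⟩ := mem_closure_iff.1 hwE U hUo hw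
      exact Set.disjoint_left.1 hUV heU (hEV heE)
    have hUDE : U ⊆ D.carrier ∪ E := by
      rw [hDEu]
      exact hUF
    rcases hUc.isPreconnected.subset_or_subset D.isOpen hEo hDE hUDE with h | h
    · exact ⟨h hz, fun hzL => hzJ (Or.inl hzL)⟩
    · exfalso
      exact Set.disjoint_left.1 hUV hz (hEV (h hz))
  have hU₁D : U₁ ⊆ D.carrier \ L := key hU₁o hU₁c hUV₁ hunion₁ hEV₁
  have hU₂D : U₂ ⊆ D.carrier \ L := key hU₂o hU₂c hUV₂ hunion₂ hEV₂
  -- `D ∖ L` misses both curves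
  have hDLJ : ∀ A ⊆ frontier D.carrier, D.carrier \ L ⊆ (L ∪ A)ᶜ := by
    rintro A hA z ⟨hzD, hzL⟩ (h | h)
    · exact hzL h
    · exact Set.disjoint_left.1 D.disjoint_carrier_frontier hzD (hA h)
  -- the two insides are disjoint
  have hdisj : Disjoint U₁ U₂ := by
    rw [Set.disjoint_iff]
    rintro w ⟨hw₁, hw₂⟩
    have h21 : U₂ ⊆ U₁ := by
      rcases hU₂c.isPreconnected.subset_or_subset hU₁o hV₁o hUV₁
        ((hU₂D.trans (hDLJ A₁ hA₁F)).trans hunion₁.symm.subset) with h | h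
      · exact h
      · exact absurd (h hw₂) (Set.disjoint_left.1 hUV₁ hw₁)
    have h12 : U₁ ⊆ U₂ := by
      rcases hU₁c.isPreconnected.subset_or_subset hU₂o hV₂o hUV₂
        ((hU₁D.trans (hDLJ A₂ hA₂F)).trans hunion₂.symm.subset) with h | h
      · exact h
      · exact absurd (h hw₁) (Set.disjoint_left.1 hUV₂ hw₂)
    have heq : U₁ = U₂ := h12.antisymm h21
    have hfr : L ∪ A₁ = L ∪ A₂ := by rw [← hfU₁, heq, hfU₂]
    -- the midpoint of `A₁` is not on `J₂`
    have hm : D.boundary ((s + t) / 2) ∈ L ∪ A₂ :=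
      hfr ▸ Or.inr ⟨(s + t) / 2, ⟨by linarith, by linarith⟩, rfl⟩
    rcases hm with hmL | ⟨v', hv', hv'm⟩
    · rcases hLF _ hmL (D.boundary_mem_frontier _) with h | h
      · have := D.injOn_boundary_Ico s ⟨by linarith, by linarith⟩ ⟨le_rfl, by linarith⟩ h
        linarith
      · have := D.injOn_boundary_Ico s ⟨by linarith, by linarith⟩ ⟨hst.le, hts⟩ h
        linarith
    · rcases eq_or_lt_of_le hv'.2 with rfl | hv'1
      · rw [D.periodic_boundary] at hv'm
        have := D.injOn_boundary_Ico s ⟨le_rfl, by linarith⟩ ⟨by linarith, by linarith⟩ hv'm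
        linarith
      · have := D.injOn_boundary_Ico s ⟨by linarith [hv'.1], hv'1⟩ ⟨by linarith, by linarith⟩
          hv'm
        linarith [hv'.1]
  -- Janiszewski: `D ∖ L` is covered by the two insides
  have hcover : D.carrier \ L ⊆ U₁ ∪ U₂ := by
    intro z hz
    by_contra hzU
    simp only [mem_union, not_or] at hzU
    have hzV₁ : z ∈ V₁ := (hunion₁.symm.subset (hDLJ A₁ hA₁F hz)).resolve_left hzU.1
    have hzV₂ : z ∈ V₂ := (hunion₂.symm.subset (hDLJ A₂ hA₂F hz)).resolve_left hzU.2
    obtain ⟨y, hy⟩ := hEc.nonempty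
    have hy₁ : y ∈ connectedComponentIn (L ∪ A₁)ᶜ z :=
      hV₁c.isPreconnected.subset_connectedComponentIn hzV₁ (hunion₁ ▸ subset_union_right)
        (hEV₁ hy)
    have hy₂ : y ∈ connectedComponentIn (L ∪ A₂)ᶜ z :=
      hV₂c.isPreconnected.subset_connectedComponentIn hzV₂ (hunion₂ ▸ subset_union_right)
        (hEV₂ hy)
    have hinter : (L ∪ A₁) ∩ (L ∪ A₂) = L := by
      apply Subset.antisymm
      · rintro w ⟨hw₁ | hw₁, hw₂ | hw₂⟩
        · exact hw₁
        · exact hw₁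
        · exact hw₂
        · rcases hA₁A₂ ⟨hw₁, hw₂⟩ with rfl | rfl
          · exact hLarc.left_mem
          · exact hLarc.right_mem
      · exact fun w hw => ⟨Or.inl hw, Or.inl hw⟩
    have hjan := janiszewski (hLarc.isCompact.union hA₁arc.isCompact)
      (hLarc.isCompact.union hA₂arc.isCompact)
      (by rw [hinter]; exact hLarc.isConnected.isPreconnected) hy₁ hy₂
    have hsub : connectedComponentIn ((L ∪ A₁) ∪ (L ∪ A₂))ᶜ z ⊆ D.carrier ∪ E := by
      intro w hw
      have hw' : w ∈ ((L ∪ A₁) ∪ (L ∪ A₂))ᶜ := connectedComponentIn_subset _ _ hw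
      rw [hDEu]
      intro hwF
      rw [hFA] at hwF
      rcases hwF with h | h
      · exact hw' (Or.inl (Or.inr h))
      · exact hw' (Or.inr (Or.inr h))
    rcases isPreconnected_connectedComponentIn.subset_or_subset D.isOpen hEo hDE hsub with h | h
    · exact Set.disjoint_left.1 hDE (h hjan) hy
    · have hzmem : z ∈ connectedComponentIn ((L ∪ A₁) ∪ (L ∪ A₂))ᶜ z :=
        mem_connectedComponentIn (connectedComponentIn_nonempty_iff.1 ⟨y, hjan⟩)
      exact Set.disjoint_left.1 hDE hz.1 (h hzmem)
  exact ⟨U₁, U₂, hU₁o, hU₂o, hU₁c, hU₂c, hdisj, (union_subset hU₁D hU₂D).antisymm hcover,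
    hfU₁, hfU₂⟩

end Literature.Topology.PlaneTopology
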